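import Summits.MatrixMultiplication.MatrixMultiplication.Theorems.HyperoctahedralThreshold.Negative.SubgroupPivotSieve
import Summits.MatrixMultiplication.MatrixMultiplication.Theses.SnThresholdCensus

/-!
# Refutation of `SnThresholdCensus.ThresholdSubgroupTriples` (stmt-MatrixMultiplication-10879)

The target of route `SnThresholdCensus` asks, for EVERY `c > 0`, for subgroup triples of `S_n` with the
subgroup TPP and `|H₀||H₁||H₂| > (n!)^{3/2}·e^{-c√n}` infinitely often.  By the subgroup-pivot sieve
(`Theorems/HyperoctahedralThreshold/Negative/SubgroupPivotSieve.lean`, `subgroup_sieve`: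
`|H₀||H₁||H₂| ≤ |G|·d_max(G)` for every TPP triple of subgroups of any finite group) and the tree's
Vershik–Kerov theorem (`d_max(S_n) ≤ √(n!)·e^{-(c₂-ε)√n}`, `c₂ = vkUpperConst = (π-2)/π²`), every such
triple has `|H₀||H₁||H₂| ≤ n!·d_max(S_n) ≤ (n!)^{3/2}·e^{-(c₂/2)√n}` for `n ≥ n₀`; so the target fails at
`c := c₂/2`.  This settles, on the subgroup side, the "smaller step" left open in
Blasiak–Church–Cohn–Grochow–Umans (arXiv:1712.02302, §4): no TPP triple of subgroups of `S_n` reaches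
the `e^{-o(√n)}` slack that would prove `ω = 2`.
-/

namespace Summit.MatrixMultiplication.MatrixMultiplication.Theorems

open Literature.RepresentationTheory.FiniteGroups
open Summit.MatrixMultiplication.MatrixMultiplication.Theses.SnThresholdCensus
open Summit.MatrixMultiplication.MatrixMultiplication.Theorems.HyperoctahedralThreshold.Negative

/-- Refutes `SnThresholdCensus.ThresholdSubgroupTriples` [refuted-substantive]: for every subgroup TPP
triple of `S_n`, `|H₀||H₁||H₂| ≤ n!·d_max(S_n)` (subgroup-pivot sieve: the `|H₁||H₂|` coset indicators
`δ_{t⁻¹} * 1_{H₀} * δ_{u'}` are linearly independent inside the two-sided ideal of `1_{H₀}`, whose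
dimension is `≤ d_max·[G:H₀]`), and `n!·d_max(S_n) ≤ (n!)^{3/2}e^{-(c₂/2)√n}` eventually (Vershik–Kerov,
tree theorem); witness of falsity: `c := vkUpperConst/2`, any `n₀` from VK.  No cheap repair: the bound
holds for ALL subgroup triples of ALL finite groups (`|H₀||H₁||H₂| ≤ |G|·d_max(G)`, the trivial point of
CKSU Cor. 1.9), so neither restricting hosts nor changing the family helps, and the `∃ c` weakening no
longer decides `ω`; barrier-candidate: SubgroupPivotBarrier — a TPP triple with a subgroup (coset,
coset-majority) member never exceeds `|G|·d_max(G)`. -/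
theorem SnThresholdCensusThresholdSubgroupTriples_refuted : ¬ ThresholdSubgroupTriples := by
  intro hT
  have hc := vkUpperConst_pos
  obtain ⟨n₀, hn₀⟩ := VershikKerov1985_maxCharDegree_holds (vkUpperConst / 2) (by linarith)
  obtain ⟨n, hn, H, hTPP, hlt⟩ := hT (vkUpperConst / 2) (by linarith) n₀
  have hnat := subgroup_sieve (H 0) (H 1) (H 2) hTPP
  rw [show Nat.card (Equiv.Perm (Fin n)) = n.factorial by
      rw [Nat.card_eq_fintype_card, Fintype.card_perm, Fintype.card_fin]] at hnat
  have hreal : ((Nat.card (H 0) * Nat.card (H 1) * Nat.card (H 2) : ℕ) : ℝ) ≤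
      (n.factorial : ℝ) * (maxCharDegree (Equiv.Perm (Fin n)) : ℝ) := by exact_mod_cast hnat
  have hVK := (show vkUpperConst - vkUpperConst / 2 = vkUpperConst / 2 by ring) ▸ (hn₀ n hn).2
  have hF : (0 : ℝ) ≤ (n.factorial : ℝ) := Nat.cast_nonneg _
  have hpow : (n.factorial : ℝ) ^ ((3 : ℝ) / 2) = (n.factorial : ℝ) * Real.sqrt (n.factorial : ℝ) := by
    rw [show ((3 : ℝ) / 2) = 1 + (1 / 2 : ℝ) by norm_num, Real.rpow_add' hF (by norm_num),
      Real.rpow_one, Real.sqrt_eq_rpow]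
  have hle : ((Nat.card (H 0) * Nat.card (H 1) * Nat.card (H 2) : ℕ) : ℝ) ≤
      (n.factorial : ℝ) ^ ((3 : ℝ) / 2) * Real.exp (-(vkUpperConst / 2 * Real.sqrt (n : ℝ))) :=
    calc ((Nat.card (H 0) * Nat.card (H 1) * Nat.card (H 2) : ℕ) : ℝ)
        ≤ (n.factorial : ℝ) * (maxCharDegree (Equiv.Perm (Fin n)) : ℝ) := hreal
      _ ≤ (n.factorial : ℝ) * (Real.sqrt (n.factorial : ℝ) *
            Real.exp (-(vkUpperConst / 2 * Real.sqrt (n : ℝ)))) :=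
          mul_le_mul_of_nonneg_left hVK hF
      _ = (n.factorial : ℝ) ^ ((3 : ℝ) / 2) * Real.exp (-(vkUpperConst / 2 * Real.sqrt (n : ℝ))) := by
          rw [hpow, mul_assoc]
  exact absurd hle (not_le.2 hlt)

end Summit.MatrixMultiplication.MatrixMultiplication.Theorems
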